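import Summits.ValiantsHypothesis.ValiantsHypothesis.Theses.AnyonJets
import Summits.ValiantsHypothesis.ValiantsHypothesis.Theorems.AnyonJetsJetConstantElimMultiplierBypassNamed

/-!
# Route AnyonJets (rev 3) — the re-glued cruxes `JetConstantElimTwoAdic` (stmt-23655) and
# `ConstantFreeJetGrowthUltimate` (stmt-23656): bridges to the landed bypass

The tenure planner filed the two "ultimate" cruxes of the multiplier bypass as route items
(rev 3 of `Theses/AnyonJets.lean`): `JetConstantElimTwoAdic` (`CE^ult₂`, verbatim the hypothesis
`hCE` of `closes_ultimate_twoAdic`) and `ConstantFreeJetGrowthUltimate` (`CF^ult`, verbatim `hCF`).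
This file connects them BY NAME to the landed vocabulary (`AnyonJetsJetConstantElimDefs.lean`) and
theorems (`…MultiplierBypass{,Boolean,TwoAdic,Named}.lean`):

* `jetConstantElimTwoAdic_iff`, `constantFreeJetGrowthUltimate_iff` — the items are `∃ b,
  CEUltTwoAdicWith b` / `∀ c ∃ k ≥ 1, CFUltAt c k` (`Iff.rfl`);
* `valiant_of_ultimateItems : ConstantFreeJetGrowthUltimate → JetConstantElimTwoAdic →
  UniformJetUpperBound → ValiantsHypothesis` — the re-glued `closes` (= `closes_ultimate_twoAdic`);
  `jetExponentUnbounded_of_ultimateItems` — the route's target from the two new cruxes;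
* `constantFreeJetGrowthUltimate_of_perModPowBooleanHard` — the new CF-side crux from the route's
  Boolean far side (p583838); `constantFreeJetGrowth_of_ultimate'` — it implies the old one;
* `jetConstantElimTwoAdic_of_integralMultipleTwoAdic` — the new CE-side crux from its ONE open
  stub `∃ b₁, IntegralMultipleTwoAdicWith b₁` (descent and sign simulation landed);
  `jetConstantElimTwoAdic_of_jetConstantElim` — it is WEAKER than the old crux `JetConstantElim`.

Honest framing: bridges and CONDITIONAL implications only; both new cruxes are OPEN (23656 held as a
Boolean-hardness residual); VP ≠ VNP is NOT proved.
-/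

noncomputable section

-- single-conjunct layout: Sub = Summit, duplicated namespace component intended
set_option linter.dupNamespace false

namespace Summit.ValiantsHypothesis.ValiantsHypothesis.Theorems.AnyonJets.JetConstantElim

open MvPolynomial Literature.Computability.AlgebraicComplexity
open Summit.ValiantsHypothesis.ValiantsHypothesis.Theses.AnyonJets
open Summit.ValiantsHypothesis.ValiantsHypothesis.Theorems.AnyonJets.ConstantFreeJetGrowth (jet)

/-- The item `JetConstantElimTwoAdic` (stmt-23655) is `∃ b, CEUltTwoAdicWith b` (rfl). [folklore] -/
theorem jetConstantElimTwoAdic_iff : JetConstantElimTwoAdic ↔ ∃ b : ℕ, CEUltTwoAdicWith b :=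
  Iff.rfl

/-- The item `ConstantFreeJetGrowthUltimate` (stmt-23656) is `∀ c, ∃ k ≥ 1, CFUltAt c k` (rfl).
[folklore] -/
theorem constantFreeJetGrowthUltimate_iff :
    ConstantFreeJetGrowthUltimate ↔ ∀ c : ℕ, ∃ k : ℕ, 1 ≤ k ∧ CFUltAt c k :=
  Iff.rfl

/-- **The re-glued deciding theorem**: `ConstantFreeJetGrowthUltimate → JetConstantElimTwoAdic →
UniformJetUpperBound → VP_ℂ ≠ VNP_ℂ` (= `closes_ultimate_twoAdic`). [folklore] -/
theorem valiant_of_ultimateItems (hCF : ConstantFreeJetGrowthUltimate) (hCE : JetConstantElimTwoAdic)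
    (hU : UniformJetUpperBound) : _root_.ValiantsHypothesis :=
  closes_ultimate_twoAdic hCF hCE hU

/-- **The route's target from the two new cruxes**: `ConstantFreeJetGrowthUltimate →
JetConstantElimTwoAdic → JetExponentUnbounded`. [folklore] -/
theorem jetExponentUnbounded_of_ultimateItems (hCF : ConstantFreeJetGrowthUltimate)
    (hCE : JetConstantElimTwoAdic) : JetExponentUnbounded :=
  jetExponentUnbounded_of_ultimate_twoAdic hCF hCE

/-- **`PerModPowBooleanHard → ConstantFreeJetGrowthUltimate`**: the new constant-free crux from the
route's Boolean far side (multipliers dissolve in the Boolean shadow, p583838). CONDITIONAL on the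
open support `PerModPowBooleanHard`. [cite: Burgisser2000TCS, §5 (A3)] -/
theorem constantFreeJetGrowthUltimate_of_perModPowBooleanHard (hHard : PerModPowBooleanHard) :
    ConstantFreeJetGrowthUltimate :=
  cfUltimate_of_perModPowBooleanHard hHard

/-- `ConstantFreeJetGrowthUltimate → ConstantFreeJetGrowth` (`M = 1`): the new CF-side crux is
STRONGER than the old. [folklore] -/
theorem constantFreeJetGrowth_of_ultimate' (hCF : ConstantFreeJetGrowthUltimate) :
    ConstantFreeJetGrowth :=
  cfGrowth_of_ultimate hCF

/-- **`stub_integralMultiple₂ → JetConstantElimTwoAdic`**: the new CE-side crux follows from its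
one open stub (`∃ b₁, IntegralMultipleTwoAdicWith b₁`; descent p575059 and sign simulation p575638
are landed) — no multiplier removal. CONDITIONAL on that stub. [folklore] -/
theorem jetConstantElimTwoAdic_of_integralMultipleTwoAdic (hI : ∃ b₁ : ℕ, IntegralMultipleTwoAdicWith b₁) :
    JetConstantElimTwoAdic :=
  ceUltTwoAdic_of_integralMultipleTwoAdic hI

/-- `JetConstantElim → JetConstantElimTwoAdic` (`M = 1`): the new CE-side crux is WEAKER than the
old one (stmt-16737), so every line on `JetConstantElim` also serves it. [folklore] -/
theorem jetConstantElimTwoAdic_of_jetConstantElim (hCE : JetConstantElim) : JetConstantElimTwoAdic :=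
  ceUltTwoAdic_of_jetConstantElim hCE

end Summit.ValiantsHypothesis.ValiantsHypothesis.Theorems.AnyonJets.JetConstantElim

end
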